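import Summits.QuantumFields.BalabanUV.Beta.GAN24.EffectiveFormDecay

/-!
# `BalabanUV.Beta.GAN24.EffectiveFormDecayBackground` — binder row G-an2-4 ∕ (CONV-C), routes R6 × R7, PART 129: ROUTE R6's END WITH (PERTURBATIVE) BACKGROUND IN BOTH
# CURRENCIES.  The perturbed unit-lattice block propagators `c_k(t) = (L^d)^k·Q_k(Δ_a^{(k)} + tP_k)⁻¹Q_kᴴ` on Bałaban's (1.18)-averaged tower are NOT Hermitian (complex
# coupling, non-symmetric `P`), so PART 127's Hermitian Combes–Thomas step does not apply to them; this file proves the ACCRETIVE twin — the conjugation defect of ANY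
# decaying kernel is SMALL IN OPERATOR NORM, linearly in the rate (`‖e^{κ′ρ}Ae^{−κ′ρ} − A‖ ≤ κ′·B·S∕c`, Schur test), so a `Re`-coercive decaying kernel has a decaying inverse
# — and runs it on `c_k(t)`: `Re`-coercive by `uniformCoercive_unitCovB` + the Lipschitz bound in the coupling, decaying by PART 126's dictionary on `(Δ_a + tP)⁻¹`
# (`opNorm_conjMat_pertInv_le_of_wCoercive`).  Joined with PART 118's `effForm_perturbed_balaban` this is `|𝒮_{j+1}(t)(x,y) − 𝒮_j(t)(x,y)| ≤ B·(√(L⁻¹))^j·e^{−δ·distK(x,y)}` for the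
# effective form WITH background — ONE `(δ, B)` for all tori and all couplings in a closed disc, NO letter, first-order model UNCONDITIONAL (unit b2b-balaban-gan24-p3, gen 52; v1)

NOT IN PRINT; OUR PROOF ([folklore] BY NAME over PARTs 118 ∕ 124 ∕ 126 ∕ 127 ∕ 128, NE2's `BackgroundResolventTower.opNorm_avgTow_perturbed_sub_le` and `BalabanAveragedCoerciveTower`,
the substrate's `CTWeightedCoercivity` (`conjDefect_of_opNorm`, `wCoercive_of_coercive`) and `CovariantBlockAveraging.opNorm_le_sqrt_of_schur`, the NE2 swarm's
`CTAveragedTowerDecay.opNorm_conjMat_pertInv_le_of_wCoercive`, b05's `B5Prop11Lower.norm_form_le`, the owner's `DecayRateInterpolation.decayStations_of_rate`; nothing printed is a hypothesis).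
HONEST FRAMING (cell contract, verbatim): «discharging `BetaPertH` makes Bałaban's UV stability UNCONDITIONAL — a real constructive-QFT result; it is NOT the
continuum limit and NOT the Clay problem.»  HONEST DEPENDENCY (verbatim): «continuum YM on T⁴ ⇐ BetaPertH ∧ nine spine estimates (0/9 proved); BetaPertH ⇐
(D1) ∧ (D4) ∧ CAP+tail; G-an2-4 gates asym, D1 and NE2/3/4.»

WHAT THIS FILE PROVES (0 sorry, 0 `def`, nothing cited; `c_k(t)` as above on Bałaban's tower, `γ_B = gammaB d a`, `κ₀ = d(α+β)Cst` the model's (H-bd), `κ_c` its conjugated (H-bd)):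
* §1 `coercive_add_of_opNorm_le`; **`opNorm_conjMat_sub_le_of_entryDecay`** (`EntryDecay dist A B κ`, `ρ` 1-Lipschitz, `0 ≤ κ′ ≤ κ₀ < κ`, letter `S` at rate
  `(κ−κ₀)∕2` ⟹ `‖e^{κ′ρ}Ae^{−κ′ρ} − A‖ ≤ κ′·B·S∕((κ−κ₀)∕2)`, Schur); **`entryDecay_inv_of_reCoercive`** (`Re`-coercive + decaying ⟹ the inverse decays at every small `κ′`, NO Hermitian
  hypothesis, smallness LINEAR in `κ′`); `entryDecay_inv_distK_re` (the unit torus, letter from PART 127's `sum_exp_distK_le`, `d ≥ 2`).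
* §2 `hdecB_pert_of_wCoercive` (`hW`, `hPc`, `‖t‖κ_c < 1` ⟹ `EntryDecay distK (c_k(t)) (γw⁻¹(1 − ‖t‖κ_c)⁻¹e^{4κ}) κ`); `coercive_pertCov_QB` (`Coercive (γ_B − ‖t‖κ₀Cst(1 − ‖t‖κ₀)⁻¹) (c_k(t))`).
* §3 the first-order model on a coupling disc `‖t‖ ≤ T` (`T·κ₀ ≤ 1∕2`, `T·κ_c ≤ 1∕2`, `4T·κ₀·Cst ≤ γ_B`; an admissible fine rate `κ`): **`exists_decay_inv_pertCov_QB`** (`∃ κ′ B′ > 0` with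
  `EntryDecay distK (c_k(t)⁻¹) B′ κ′` for EVERY torus, background, `‖t‖ ≤ T`, `k`); **`twoLevelDecayRate_effForm_perturbed`** (`∃ κ′ B`: `TwoLevelDecayRate distK (k ↦ c_k(t)⁻¹ − a″·1) B (κ′∕2) (√(L⁻¹))`
  for every `M`, `V`, `‖t‖ ≤ T`, `a″` — R6's END WITH background AND decay, NO (STAB)^{cov} ∕ (CONS) ∕ `τ_j` ∕ UB ∕ `hdec` letter).
WHAT IT DOES NOT DO: large couplings; Bałaban's shaped `P_B` on the (1.18) tower; second u-derivatives; ℤ^d.  SUPPLIER work; no consumer of record; NEVER «G-an2-4 closed»; NOT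
(CONV-C), NOT D1, NOT `BetaPertH`, NOT continuum, NOT Clay.  Records: `HOME/b2b-balaban-gan24-p3/gen52/README.md`.
-/

noncomputable section

open scoped BigOperators ComplexConjugate Matrix Matrix.Norms.L2Operator
open Filter Topology

namespace Summit.QuantumFields.BalabanUV.Beta.GAN24.EffectiveFormDecayBackground

open Literature.MathematicalPhysics.QuantumFieldTheory.Balaban1983to89.B5Prop11Plancherel (Cst Cst_nonneg Tor fine)
open Literature.MathematicalPhysics.QuantumFieldTheory.Balaban1983to89.B5Prop11Lower (nsq nsq_nonneg norm_form_le)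
open Literature.MathematicalPhysics.QuantumFieldTheory.Balaban1983to89.B5G183RateUnitTower (lev)
open Summit.QuantumFields.BalabanUV.T4Continuum
open Summit.QuantumFields.BalabanUV.T4Continuum.CoerciveInverseTower (Coercive)
open Summit.QuantumFields.BalabanUV.T4Continuum.CovariantAveragingTower (avgTow)
open Summit.QuantumFields.BalabanUV.T4Continuum.BalabanAveragedTowerUnit (idx QBlev calGlev unitCovB one_le_lev' opNorm_QBlev_sq_le norm_entry_le_opNorm)
open Summit.QuantumFields.BalabanUV.T4Continuum.BalabanAveragedCoercive (gammaB gammaB_pos)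
open Summit.QuantumFields.BalabanUV.T4Continuum.BalabanAveragedCoerciveTower (uniformCoercive_unitCovB)
open Summit.QuantumFields.BalabanUV.T4Continuum.BalabanLineAverage (CQB)
open Summit.QuantumFields.BalabanUV.T4Continuum.BackgroundResolventTower (PerturbationLaws Cpert opNorm_avgTow_perturbed_sub_le)
open Summit.QuantumFields.BalabanUV.T4Continuum.KingPairingPlantedLaw (JpcT calDalev calDalev_inv CJ CJ_nonneg isUnit_det_calDalev opNorm_inv_calDalev_le)
open Summit.QuantumFields.BalabanUV.T4Continuum.FirstOrderBackgroundModel (LipschitzBackground Pmodel C2model perturbationLaws_firstOrder)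
open Summit.QuantumFields.BalabanUV.T4Continuum.CTWeightedCoercivity (conjMat conjMat_apply ConjDefect WCoercive conjDefect_of_opNorm wCoercive_of_coercive)
open Summit.QuantumFields.BalabanUV.T4Continuum.CTAveragedTowerDecay (opNorm_conjMat_inv_le_of_wCoercive opNorm_conjMat_pertInv_le_of_wCoercive)
open Summit.QuantumFields.BalabanUV.T4Continuum.CovariantBlockAveraging (opNorm_le_sqrt_of_schur)
open Summit.QuantumFields.BalabanUV.T4Continuum.CTKingTowerWeights (rho distK distK_comm)
open Summit.QuantumFields.BalabanUV.T4Continuum.CTConjugatedHbd (G2 G2_nonneg wCoercive_calDa_of_conjDefect)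
open Summit.QuantumFields.BalabanUV.T4Continuum.CTConjDefectDischarge (conjDefect_calDalev_rho max_JA_lt_gamD)
open Summit.QuantumFields.BalabanUV.T4Continuum.CTAdmissibleRate (exists_pos_le_one_of_eventually)
open Summit.QuantumFields.BalabanUV.T4Continuum.DirichletRegionTower (gamD gamD_pos)
open Summit.QuantumFields.BalabanUV.T4Continuum.ScalarAveragedPropagator (gammaPs)
open Summit.QuantumFields.BalabanUV.T4Continuum.ScalarAveragedCompression (sigma0)
open Summit.QuantumFields.BalabanUV.T4Continuum.CTScalarGreen (Jfree)
open Summit.QuantumFields.BalabanUV.T4Continuum.CTGaugeTerm (deltaK)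
open Summit.QuantumFields.BalabanUV.T4Continuum.CTVectorPropagator (JA)
open Summit.QuantumFields.BalabanUV.T4Continuum.DecayRateInterpolation (EntryDecay DecayRate TwoLevelDecayRate decayStations_of_rate)
open Summit.QuantumFields.BalabanUV.Beta.GAN24.InsertionChainDecay (hPc_firstOrder)
open Summit.QuantumFields.BalabanUV.Beta.GAN24.InsertionChainDecayBalaban (hdecB_of_conjBound)
open Summit.QuantumFields.BalabanUV.Beta.GAN24.UnitLatticeDecayAlgebra (abs_dist_sub_dist_le distK_nonneg distK_self distK_triangle sum_exp_distK_le)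
open Summit.QuantumFields.BalabanUV.Beta.GAN24.EffectiveFormInsertionLaw (effForm_perturbed_balaban)
open Summit.QuantumFields.BalabanUV.Beta.GAN24.EffectiveFormDecay (entryDecay_of_le_rate)

/-! ## §1 The accretive Combes–Thomas step on an index set: conjugation defects of decaying kernels are small in operator norm -/

section Generic

variable {n : Type*} [Fintype n] [DecidableEq n] {dist : n → n → ℝ}

/-- `Re`-coercivity is stable under operator-norm-small perturbations: `Coercive γ A`, `‖E‖ ≤ δ` ⟹ `Coercive (γ − δ) (A + E)`. [folklore] -/
theorem coercive_add_of_opNorm_le {A E : Matrix n n ℂ} {γ δ : ℝ} (hA : Coercive γ A) (hE : ‖E‖ ≤ δ) : Coercive (γ - δ) (A + E) := by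
  intro z
  have h1 := hA z
  have h2 : ‖star z ⬝ᵥ (E *ᵥ z)‖ ≤ δ * nsq z := by
    refine (norm_form_le E z z).trans ?_
    rw [Real.mul_self_sqrt (nsq_nonneg z)]
    exact mul_le_mul_of_nonneg_right hE (nsq_nonneg z)
  have h3 : -(δ * nsq z) ≤ (star z ⬝ᵥ (E *ᵥ z)).re := by
    have := Complex.abs_re_le_norm (star z ⬝ᵥ (E *ᵥ z))
    have := neg_le_of_abs_le (this.trans h2)
    exact this
  rw [Matrix.add_mulVec, dotProduct_add, Complex.add_re]
  linarith

/-- **`opNorm_conjMat_sub_le_of_entryDecay`** [our proof]: `EntryDecay dist A B κ` (`B ≥ 0`), `dist` symmetric `≥ 0`, `ρ` 1-Lipschitz, `0 ≤ κ′ ≤ κ₀ < κ`, letter `S ≥ 0` at rate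
`(κ−κ₀)∕2` ⟹ `‖e^{κ′ρ}Ae^{−κ′ρ} − A‖ ≤ κ′·B·S∕((κ−κ₀)∕2)` (entries `|e^{κ′Δρ} − 1|·|A| ≤ κ′·d·e^{κ₀d}·B·e^{−κd} ≤ (κ′B∕c)·e^{−cd}`, then the rectangular Schur test). -/
theorem opNorm_conjMat_sub_le_of_entryDecay {A : Matrix n n ℂ} {B κ κ₀ κ' S : ℝ} (hA : EntryDecay dist A B κ) (hB : 0 ≤ B)
    (hsymm : ∀ x y, dist x y = dist y x) (hd0 : ∀ x y, 0 ≤ dist x y) {ρ : n → ℝ} (hρ : ∀ e e', |ρ e - ρ e'| ≤ dist e e') (hκ' : 0 ≤ κ')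
    (hle : κ' ≤ κ₀) (hc : κ₀ < κ) (hS0 : 0 ≤ S) (hS : ∀ e, ∑ e', Real.exp (-((κ - κ₀) / 2 * dist e e')) ≤ S) :
    ‖conjMat κ' ρ ρ A - A‖ ≤ κ' * B * S / ((κ - κ₀) / 2) := by
  set c : ℝ := (κ - κ₀) / 2 with hcdef
  have hc0 : 0 < c := by rw [hcdef]; linarith
  -- entry bound
  have hentry : ∀ e e', ‖(conjMat κ' ρ ρ A - A) e e'‖ ≤ κ' * B / c * Real.exp (-(c * dist e e')) := by
    intro e e'
    have hdee : 0 ≤ dist e e' := hd0 e e'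
    rw [Matrix.sub_apply, conjMat_apply, show ((Real.exp (κ' * (ρ e - ρ e')) : ℝ) : ℂ) * A e e' - A e e'
        = (((Real.exp (κ' * (ρ e - ρ e')) - 1 : ℝ)) : ℂ) * A e e' by push_cast; ring, norm_mul, Complex.norm_real, Real.norm_eq_abs]
    -- `|e^{κ′Δρ} − 1| ≤ e^{κ′d} − 1 ≤ κ′d·e^{κ′d} ≤ κ′d·e^{κ₀d}`
    have h1 : |Real.exp (κ' * (ρ e - ρ e')) - 1| ≤ Real.exp (κ' * dist e e') - 1 := by
      have := CTConjugationPieces.abs_exp_mul_sub_one_le (κ := κ') (hρ e e')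
      rwa [abs_of_nonneg hκ'] at this
    -- `e^x − 1 ≤ x·e^x` (in the tree as `Literature.…AreaLaw.exp_sub_one_le_mul_exp`; three lines here to keep the import cone physical)
    have hexp1 : ∀ x : ℝ, Real.exp x - 1 ≤ x * Real.exp x := fun x => by
      have h := Real.add_one_le_exp (-x)
      have hpos := Real.exp_pos x
      have : Real.exp (-x) * Real.exp x = 1 := by rw [← Real.exp_add, neg_add_cancel, Real.exp_zero]
      nlinarith
    have h2 : Real.exp (κ' * dist e e') - 1 ≤ κ' * dist e e' * Real.exp (κ₀ * dist e e') :=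
      (hexp1 _).trans
        (mul_le_mul_of_nonneg_left (Real.exp_le_exp.mpr (mul_le_mul_of_nonneg_right hle hdee)) (mul_nonneg hκ' hdee))
    -- `d ≤ e^{cd}/c`
    have h3 : dist e e' ≤ Real.exp (c * dist e e') / c := by
      rw [le_div_iff₀ hc0]
      have := Real.add_one_le_exp (c * dist e e')
      nlinarith
    have hAe := hA e e'
    calc |Real.exp (κ' * (ρ e - ρ e')) - 1| * ‖A e e'‖
        ≤ (κ' * dist e e' * Real.exp (κ₀ * dist e e')) * (B * Real.exp (-(κ * dist e e'))) :=
          mul_le_mul (h1.trans h2) hAe (norm_nonneg _) (by positivity)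
      _ ≤ (κ' * (Real.exp (c * dist e e') / c) * Real.exp (κ₀ * dist e e')) * (B * Real.exp (-(κ * dist e e'))) := by
          gcongr
      _ = κ' * B / c * (Real.exp (c * dist e e') * Real.exp (κ₀ * dist e e') * Real.exp (-(κ * dist e e'))) := by
          field_simp
      _ = κ' * B / c * Real.exp (-(c * dist e e')) := by
          rw [← Real.exp_add, ← Real.exp_add]; congr 2; rw [hcdef]; ring
  -- row and column sums, then the rectangular Schur test
  have hK : 0 ≤ κ' * B / c := by positivity
  have hrow : ∀ e, ∑ e', ‖(conjMat κ' ρ ρ A - A) e e'‖ ≤ κ' * B / c * S := fun e =>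
    (Finset.sum_le_sum fun e' _ => hentry e e').trans (by rw [← Finset.mul_sum]; exact mul_le_mul_of_nonneg_left (hS e) hK)
  have hcol : ∀ e', ∑ e, ‖(conjMat κ' ρ ρ A - A) e e'‖ ≤ κ' * B / c * S := fun e' => by
    refine (Finset.sum_le_sum fun e _ => hentry e e').trans ?_
    rw [← Finset.mul_sum]
    refine mul_le_mul_of_nonneg_left ?_ hK
    calc ∑ e, Real.exp (-(c * dist e e')) = ∑ e, Real.exp (-((κ - κ₀) / 2 * dist e' e)) :=
          Finset.sum_congr rfl fun e _ => by rw [hsymm e e', hcdef]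
      _ ≤ S := hS e'
  have hKS : 0 ≤ κ' * B / c * S := mul_nonneg hK hS0
  calc ‖conjMat κ' ρ ρ A - A‖ ≤ Real.sqrt ((κ' * B / c * S) * (κ' * B / c * S)) := opNorm_le_sqrt_of_schur _ hKS hKS hrow hcol
    _ = κ' * B / c * S := Real.sqrt_mul_self hKS
    _ = κ' * B * S / ((κ - κ₀) / 2) := by rw [hcdef]; ring

/-- **`entryDecay_inv_of_reCoercive` — THE ACCRETIVE COMBES–THOMAS STEP ON AN INDEX SET** [our proof]: `Coercive γ A` (real part, NO Hermitian hypothesis), `EntryDecay dist A B κ`,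
`dist` a pseudo-metric, `0 ≤ κ′ ≤ κ₀ < κ`, letter `S` at rate `(κ−κ₀)∕2`, `J := κ′·B·S∕((κ−κ₀)∕2) < γ` ⟹ `EntryDecay dist A⁻¹ ((γ − J)⁻¹) κ′` (conjugate by `e^{κ′dist(·,y)}` per column). -/
theorem entryDecay_inv_of_reCoercive {A : Matrix n n ℂ} {γ B κ κ₀ κ' S : ℝ} (hco : Coercive γ A) (hdec : EntryDecay dist A B κ) (hB : 0 ≤ B)
    (hsymm : ∀ x y, dist x y = dist y x) (htri : ∀ x y z, dist x y ≤ dist x z + dist z y) (hd0 : ∀ x y, 0 ≤ dist x y)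
    (hself : ∀ x, dist x x = 0) (hκ' : 0 ≤ κ') (hle : κ' ≤ κ₀) (hc : κ₀ < κ) (hS0 : 0 ≤ S)
    (hS : ∀ e, ∑ e', Real.exp (-((κ - κ₀) / 2 * dist e e')) ≤ S) (hJ : κ' * B * S / ((κ - κ₀) / 2) < γ) :
    EntryDecay dist A⁻¹ ((γ - κ' * B * S / ((κ - κ₀) / 2))⁻¹) κ' := by
  intro x y
  set J : ℝ := κ' * B * S / ((κ - κ₀) / 2) with hJdef
  set ρ : n → ℝ := fun e => dist e y with hρ
  have hρL : ∀ e e', |ρ e - ρ e'| ≤ dist e e' := fun e e' => abs_dist_sub_dist_le hsymm htri y e e'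
  have hdef : ConjDefect A κ' ρ J :=
    conjDefect_of_opNorm (opNorm_conjMat_sub_le_of_entryDecay hdec hB hsymm hd0 hρL hκ' hle hc hS0 hS)
  have hW : WCoercive A κ' ρ (γ - J) := wCoercive_of_coercive hco hdef
  have hγJ : 0 < γ - J := sub_pos.mpr hJ
  have hop := opNorm_conjMat_inv_le_of_wCoercive hW hγJ
  have hent := (norm_entry_le_opNorm (conjMat κ' ρ ρ A⁻¹) x y).trans hop
  rw [conjMat_apply, norm_mul, Complex.norm_real, Real.norm_of_nonneg (Real.exp_pos _).le, hρ] at hent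
  simp only [hself, sub_zero] at hent
  have hexp : 0 < Real.exp (κ' * dist x y) := Real.exp_pos _
  rw [Real.exp_neg, ← div_eq_mul_inv, le_div_iff₀ hexp, mul_comm]
  exact hent

end Generic

/-! ## §1′ The unit torus: the accretive step with the volume-free letter -/

section Torus

variable {d : ℕ}

/-- **`entryDecay_inv_distK_re`** — the accretive step on the unit torus with the volume-free letter `d·S((κ−κ₀)∕2, d)` of PART 127 (`d ≥ 2`, `κ₀ < κ`). [our proof] -/
theorem entryDecay_inv_distK_re (hd : 2 ≤ d) {κ κ₀ : ℝ} (hκ : κ₀ < κ) :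
    ∃ S : ℝ, 0 ≤ S ∧ ∀ (L : ℕ) [NeZero L] (M : Fin d → ℕ) [∀ μ, NeZero (M μ)] (A : Matrix (idx L M 0) (idx L M 0) ℂ) (γ B κ' : ℝ),
      Coercive γ A → EntryDecay (distK L M) A B κ → 0 ≤ B → 0 ≤ κ' → κ' ≤ κ₀ → κ' * B * (d * S) / ((κ - κ₀) / 2) < γ →
        EntryDecay (distK L M) A⁻¹ ((γ - κ' * B * (d * S) / ((κ - κ₀) / 2))⁻¹) κ' := by
  have hc : 0 < (κ - κ₀) / 2 := by linarith
  obtain ⟨S, hS0, hS⟩ := sum_exp_distK_le hd hc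
  refine ⟨S, hS0, fun L _ M _ A γ B κ' hco hdec hB hκ' hle hJ => ?_⟩
  have hdS : 0 ≤ (d : ℝ) * S := mul_nonneg (Nat.cast_nonneg d) hS0
  exact entryDecay_inv_of_reCoercive hco hdec hB (distK_comm L M) (distK_triangle L M) (distK_nonneg L M) (distK_self L M) hκ' hle hκ hdS
    (fun e => hS L M e) hJ

end Torus

/-! ## §2 Bałaban's tower with background: `hdec` and `Re`-coercivity of the perturbed block propagators -/

section Balaban

variable {d : ℕ} (L : ℕ) [NeZero L] (M : Fin d → ℕ) [hM : ∀ μ, NeZero (M μ)] (a : ℝ) (ha : 0 < a)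

/-- **`hdecB_pert_of_wCoercive`** [our proof]: PART 126's dictionary on the perturbed inverse — `hW`, `hPc : ‖c(P_k)·c((Δ_a^{(k)})⁻¹)‖ ≤ κ_c`, `‖t‖κ_c < 1` ⟹
`EntryDecay distK ((L^d)^k·Q_k(Δ_a^{(k)} + tP_k)⁻¹Q_kᴴ) (γw⁻¹(1 − ‖t‖κ_c)⁻¹e^{4κ}) κ` at every level. -/
theorem hdecB_pert_of_wCoercive {P : (k : ℕ) → Matrix (idx L M k) (idx L M k) ℂ} {κ γw κc : ℝ} (hκ : 0 ≤ κ) (hγ : 0 < γw)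
    (hW : ∀ (k : ℕ) (y : idx L M 0), WCoercive (calDalev L M a ha k) κ (rho L M k y) γw)
    (hPc : ∀ (k : ℕ) (y : idx L M 0),
      ‖conjMat κ (rho L M k y) (rho L M k y) (P k) * conjMat κ (rho L M k y) (rho L M k y) (calDalev L M a ha k)⁻¹‖ ≤ κc)
    {t : ℂ} (ht : ‖t‖ * κc < 1) (k : ℕ) :
    EntryDecay (distK L M) (avgTow (QBlev L M) ((L : ℝ) ^ d) (fun k => (calDalev L M a ha k + t • P k)⁻¹) k)
      (γw⁻¹ * (1 - ‖t‖ * κc)⁻¹ * Real.exp (κ * 4)) κ :=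
  hdecB_of_conjBound L M (X := fun k => (calDalev L M a ha k + t • P k)⁻¹) hκ
    (fun k y => opNorm_conjMat_pertInv_le_of_wCoercive (hW k y) hγ (hPc k y) ht) k

/-- coercivity is monotone in the constant. [folklore] -/
theorem coercive_mono {ι : Type*} [Fintype ι] [DecidableEq ι] {A : Matrix ι ι ℂ} {γ γ' : ℝ} (h : Coercive γ A) (hle : γ' ≤ γ) : Coercive γ' A :=
  fun z => (mul_le_mul_of_nonneg_right hle (nsq_nonneg z)).trans (h z)

/-- **`coercive_pertCov_QB`** [our proof]: for every `PerturbationLaws (Δ_a^{(·)}) P J κ₀ e₂` family and `‖t‖κ₀ < 1`, `c_k(t)` is `Re`-coercive with `γ_B − ‖t‖κ₀Cst(1 − ‖t‖κ₀)⁻¹`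
(`uniformCoercive_unitCovB` + NE2's `opNorm_avgTow_perturbed_sub_le` + §1). -/
theorem coercive_pertCov_QB {P : (k : ℕ) → Matrix (idx L M k) (idx L M k) ℂ} {κ₀ : ℝ} {e₂ : ℕ → ℝ}
    (hpert : PerturbationLaws (calDalev L M a ha) P (JpcT L M) κ₀ e₂) {t : ℂ} (ht : ‖t‖ * κ₀ < 1) (k : ℕ) :
    Coercive (gammaB d a - ‖t‖ * κ₀ * Cst d a * (1 - ‖t‖ * κ₀)⁻¹)
      (avgTow (QBlev L M) ((L : ℝ) ^ d) (fun k => (calDalev L M a ha k + t • P k)⁻¹) k) := by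
  have hr : (0 : ℝ) < (L : ℝ) ^ d := pow_pos (by exact_mod_cast Nat.pos_of_ne_zero (NeZero.ne L)) d
  have hγ : ∀ k, ‖(calDalev L M a ha k)⁻¹‖ ≤ ((Cst d a)⁻¹)⁻¹ := fun k => by rw [inv_inv]; exact opNorm_inv_calDalev_le L M a ha k
  have h := opNorm_avgTow_perturbed_sub_le hr (opNorm_QBlev_sq_le L M) (isUnit_det_calDalev L M a ha) hγ hpert.opNorm_P_mul_inv_le
    hpert.opNorm_inv_mul_P_le ht k
  rw [inv_inv] at h
  have e0 : avgTow (QBlev L M) ((L : ℝ) ^ d) (fun k => (calDalev L M a ha k)⁻¹) k = unitCovB L M a ha k := by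
    unfold unitCovB; congr 1; funext j; rw [calDalev_inv]
  rw [e0] at h
  have hco := coercive_add_of_opNorm_le (uniformCoercive_unitCovB L M a ha k) h
  have e1 : unitCovB L M a ha k + (avgTow (QBlev L M) ((L : ℝ) ^ d) (fun k => (calDalev L M a ha k + t • P k)⁻¹) k - unitCovB L M a ha k)
      = avgTow (QBlev L M) ((L : ℝ) ^ d) (fun k => (calDalev L M a ha k + t • P k)⁻¹) k := by abel
  rw [e1] at hco
  exact hco

/-! ## §3 The first-order model: the perturbed effective form in both currencies on a coupling disc, unconditionally -/

/-- `‖t‖ ≤ T`, `Tκ ≤ 1∕2`, nonnegative letters ⟹ `Cpert κ C₀ C₁ C₂ Cf t ≤ 4(C₁ + TC₂) + 2(C₀ + 2Cf)`. [folklore] -/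
theorem Cpert_le_of_norm_le {κ C₀ C₁ C₂ Cf T : ℝ} (hκ : 0 ≤ κ) (h₀ : 0 ≤ C₀) (h₁ : 0 ≤ C₁) (h₂ : 0 ≤ C₂) (hf : 0 ≤ Cf) {t : ℂ} (ht : ‖t‖ ≤ T)
    (hT : T * κ ≤ 1 / 2) : Cpert κ C₀ C₁ C₂ Cf t ≤ 4 * (C₁ + T * C₂) + 2 * (C₀ + 2 * Cf) := by
  have htκ : ‖t‖ * κ ≤ 1 / 2 := (mul_le_mul_of_nonneg_right ht hκ).trans hT
  have hν : (1 - ‖t‖ * κ)⁻¹ ≤ 2 := by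
    have h1 : (1 : ℝ) / 2 ≤ 1 - ‖t‖ * κ := by linarith
    have := inv_anti₀ (by norm_num : (0 : ℝ) < 1 / 2) h1
    rwa [one_div, inv_inv] at this
  have hν0 : 0 ≤ (1 - ‖t‖ * κ)⁻¹ := inv_nonneg.mpr (by linarith)
  have hν2 : ((1 - ‖t‖ * κ)⁻¹) ^ 2 ≤ 4 := by nlinarith
  have hT0 : 0 ≤ T := (norm_nonneg t).trans ht
  have hA : C₁ + ‖t‖ * C₂ ≤ C₁ + T * C₂ := by nlinarith [norm_nonneg t]
  have hA0 : 0 ≤ C₁ + ‖t‖ * C₂ := by positivity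
  unfold Cpert
  nlinarith [mul_le_mul hA hν2 (sq_nonneg _) (h₁.trans (le_add_of_nonneg_right (mul_nonneg hT0 h₂))),
    mul_le_mul_of_nonneg_left hν (by positivity : 0 ≤ C₀ + 2 * Cf)]

/-- **`exists_decay_inv_pertCov_QB` — THE PERTURBED BLOCK PROPAGATOR's INVERSE DECAYS, UNIFORMLY IN LEVEL, VOLUME AND COUPLING DISC** [our proof] (`d ≥ 2`; first-order model; an admissible
fine rate `κ`; `κ_c = d·α·G2(…)`, `κ₀ = d(α+β)Cst`; `T ≥ 0` with `T·κ₀ ≤ 1∕2`, `T·κ_c ≤ 1∕2`, `4T·κ₀·Cst ≤ γ_B`): `∃ κ′ B′ > 0` with `EntryDecay distK (c_k(t)⁻¹) B′ κ′` for EVERY `M`, `V`, `‖t‖ ≤ T`, `k`. -/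
theorem exists_decay_inv_pertCov_QB (hd : 2 ≤ d) {α β a' κ : ℝ} (hαβ : 0 ≤ α ∧ 0 ≤ β) (ha' : 0 < a') (hκ0 : 0 < κ)
    (hγ' : Jfree d a' κ 1 < gammaPs d a') (hδ' : deltaK d a' κ 1 < sigma0 d a' ^ 2) (hJA : JA d a a' κ 1 < gamD d a) {T : ℝ} (hT0 : 0 ≤ T)
    (hT₁ : T * (d * (α + β) * Cst d a) ≤ 1 / 2)
    (hT₂ : T * (d * (α * G2 d a (max (JA d a a' κ 1) 0) (gamD d a - max (JA d a a' κ 1) 0) κ)) ≤ 1 / 2)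
    (hT₃ : 4 * T * (d * (α + β) * Cst d a) * Cst d a ≤ gammaB d a) :
    ∃ κ' B' : ℝ, 0 < κ' ∧ 0 < B' ∧ ∀ (M : Fin d → ℕ) [∀ μ, NeZero (M μ)] (V : (k : ℕ) → Fin d → (idx L M k → ℂ))
      (_hV : LipschitzBackground L M V α β) (t : ℂ) (_ht : ‖t‖ ≤ T) (k : ℕ),
      EntryDecay (distK L M) (avgTow (QBlev L M) ((L : ℝ) ^ d) (fun k => (calDalev L M a ha k + t • Pmodel L M V k)⁻¹) k)⁻¹ B' κ' := by
  set J : ℝ := max (JA d a a' κ 1) 0 with hJdef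
  have hJ0 : 0 ≤ J := le_max_right _ _
  have hJγ : J < gamD d a := max_JA_lt_gamD a hJA
  set κc : ℝ := d * (α * G2 d a J (gamD d a - J) κ) with hκc
  set κ₀ : ℝ := d * (α + β) * Cst d a with hκ₀
  have hκ₀0 : 0 ≤ κ₀ := by have := Cst_nonneg d a; have := hαβ.1; have := hαβ.2; positivity
  have hκc0 : 0 ≤ κc := by have := G2_nonneg (d := d) a J (sub_pos.mpr hJγ) κ; have := hαβ.1; positivity
  have hγB : 0 < gammaB d a := gammaB_pos a ha
  -- the `hdec` constant on the disc: `(γ_D − J)⁻¹ · 2 · e^{4κ}`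
  set Bc : ℝ := (gamD d a - J)⁻¹ * 2 * Real.exp (κ * 4) with hBc
  have hBc0 : 0 ≤ Bc := by have := sub_pos.mpr hJγ; positivity
  -- the accretive step at reference rate `κ/2`
  obtain ⟨S, hS0, hS⟩ := entryDecay_inv_distK_re (d := d) hd (half_lt_self hκ0)
  set c : ℝ := (κ - κ / 2) / 2 with hcdef
  have hc0 : 0 < c := by rw [hcdef]; linarith
  -- choose `κ′ ∈ (0, κ/2]` with `κ′·Bc·dS/c < γ_B/2` (continuity at 0)
  have hev : ∀ᶠ κ' : ℝ in 𝓝 0, κ' * Bc * (d * S) / c < gammaB d a / 2 ∧ κ' ≤ κ / 2 := by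
    refine Filter.Eventually.and ?_ (eventually_le_nhds (half_pos hκ0))
    have hcont : Continuous fun κ' : ℝ => κ' * Bc * (d * S) / c := by fun_prop
    have h0 : (fun κ' : ℝ => κ' * Bc * (d * S) / c) 0 < gammaB d a / 2 := by simp [half_pos hγB]
    exact hcont.continuousAt.eventually_lt continuousAt_const h0
  obtain ⟨κ', hκ'0, -, hlt, hle⟩ := exists_pos_le_one_of_eventually hev
  refine ⟨κ', (gammaB d a / 2 - κ' * Bc * (d * S) / c)⁻¹, hκ'0, inv_pos.mpr (sub_pos.mpr hlt), fun M _ V hV t ht k => ?_⟩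
  have hW : ∀ (k : ℕ) (y : idx L M 0), WCoercive (calDalev L M a ha k) κ (rho L M k y) (gamD d a - J) :=
    fun k y => wCoercive_calDa_of_conjDefect (lev L k) (one_le_lev' L k) M a ha (conjDefect_calDalev_rho L M a ha ha' hγ' hδ' k y)
  have hPc : ∀ (k : ℕ) (y : idx L M 0),
      ‖conjMat κ (rho L M k y) (rho L M k y) (Pmodel L M V k) * conjMat κ (rho L M k y) (rho L M k y) (calDalev L M a ha k)⁻¹‖ ≤ κc :=
    fun k y => hPc_firstOrder L M a ha hV hJ0 hJγ k y (conjDefect_calDalev_rho L M a ha ha' hγ' hδ' k y)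
  have htc : ‖t‖ * κc < 1 := by nlinarith [mul_le_mul_of_nonneg_right ht hκc0, norm_nonneg t]
  have ht₀ : ‖t‖ * κ₀ < 1 := by nlinarith [mul_le_mul_of_nonneg_right ht hκ₀0, norm_nonneg t]
  have hdec0 := hdecB_pert_of_wCoercive L M a ha (P := Pmodel L M V) hκ0.le (sub_pos.mpr hJγ) hW hPc htc k
  have hνc : (1 - ‖t‖ * κc)⁻¹ ≤ 2 := by
    have h1 : (1 : ℝ) / 2 ≤ 1 - ‖t‖ * κc := by nlinarith [mul_le_mul_of_nonneg_right ht hκc0, norm_nonneg t]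
    have := inv_anti₀ (by norm_num : (0 : ℝ) < 1 / 2) h1
    rwa [one_div, inv_inv] at this
  have hdec : EntryDecay (distK L M) (avgTow (QBlev L M) ((L : ℝ) ^ d) (fun k => (calDalev L M a ha k + t • Pmodel L M V k)⁻¹) k) Bc κ := by
    refine hdec0.mono ?_
    rw [hBc]
    have h1 : 0 ≤ (gamD d a - J)⁻¹ := inv_nonneg.mpr (sub_pos.mpr hJγ).le
    gcongr
  have hco0 := coercive_pertCov_QB L M a ha (perturbationLaws_firstOrder L M a ha (le_trans one_le_two hd) hV) ht₀ k
  have hco : Coercive (gammaB d a / 2) (avgTow (QBlev L M) ((L : ℝ) ^ d) (fun k => (calDalev L M a ha k + t • Pmodel L M V k)⁻¹) k) := by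
    refine coercive_mono hco0 ?_
    have hν : (1 - ‖t‖ * κ₀)⁻¹ ≤ 2 := by
      have h1 : (1 : ℝ) / 2 ≤ 1 - ‖t‖ * κ₀ := by nlinarith [mul_le_mul_of_nonneg_right ht hκ₀0, norm_nonneg t]
      have := inv_anti₀ (by norm_num : (0 : ℝ) < 1 / 2) h1
      rwa [one_div, inv_inv] at this
    have hν0 : 0 ≤ (1 - ‖t‖ * κ₀)⁻¹ := inv_nonneg.mpr (by linarith)
    have hCst := Cst_nonneg d a
    have h2 : ‖t‖ * κ₀ * Cst d a * (1 - ‖t‖ * κ₀)⁻¹ ≤ T * κ₀ * Cst d a * 2 :=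
      mul_le_mul (mul_le_mul_of_nonneg_right (mul_le_mul_of_nonneg_right ht hκ₀0) hCst) hν hν0 (by positivity)
    rw [hκ₀] at h2 hT₃
    linarith
  exact hS L M _ (gammaB d a / 2) Bc κ' hco hdec hBc0 hκ'0.le hle hlt

/-- **`twoLevelDecayRate_effForm_perturbed` — ROUTE R6's END WITH (PERTURBATIVE) BACKGROUND IN BOTH CURRENCIES, UNCONDITIONALLY** [our proof] (`L ≥ 2`, `d ≥ 2`; hypotheses as above):
`∃ κ′ > 0, B` such that for EVERY torus `M`, background `V`, coupling `‖t‖ ≤ T` and regulator `a″`, `Σ_k(t) = c_k(t)⁻¹ − a″·1` obeys `‖(Σ_{k+1}(t) − Σ_k(t))(x,y)‖ ≤ B·(√(L⁻¹))^k·e^{−(κ′∕2)·distK(x,y)}`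
— NO (STAB)^{cov} ∕ (CONS) ∕ `τ_j` ∕ UB ∕ `hdec` letter (rate: PART 118's `effForm_perturbed_balaban` at `θ = 1∕2`, `Cpert(t)` made constant on the disc; decay: §3; join: `decayStations_of_rate`).
[cite: King1986, Lemma 4.5 (4.38) p.674 (shape)] -/
theorem twoLevelDecayRate_effForm_perturbed (hL : 2 ≤ L) (hd : 2 ≤ d) {α β a' κ : ℝ} (hαβ : 0 ≤ α ∧ 0 ≤ β) (ha' : 0 < a') (hκ0 : 0 < κ)
    (hγ' : Jfree d a' κ 1 < gammaPs d a') (hδ' : deltaK d a' κ 1 < sigma0 d a' ^ 2) (hJA : JA d a a' κ 1 < gamD d a) {T : ℝ} (hT0 : 0 ≤ T)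
    (hT₁ : T * (d * (α + β) * Cst d a) ≤ 1 / 2)
    (hT₂ : T * (d * (α * G2 d a (max (JA d a a' κ 1) 0) (gamD d a - max (JA d a a' κ 1) 0) κ)) ≤ 1 / 2)
    (hT₃ : 4 * T * (d * (α + β) * Cst d a) * Cst d a ≤ gammaB d a) :
    ∃ κ' B : ℝ, 0 < κ' ∧ ∀ (M : Fin d → ℕ) [∀ μ, NeZero (M μ)] (V : (k : ℕ) → Fin d → (idx L M k → ℂ))
      (_hV : LipschitzBackground L M V α β) (t : ℂ) (_ht : ‖t‖ ≤ T) (a'' : ℂ),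
      TwoLevelDecayRate (distK L M)
        (fun k => (avgTow (QBlev L M) ((L : ℝ) ^ d) (fun k => (calDalev L M a ha k + t • Pmodel L M V k)⁻¹) k)⁻¹
          - a'' • (1 : Matrix (idx L M 0) (idx L M 0) ℂ))
        B (κ' / 2) (Real.sqrt ((L : ℝ)⁻¹)) := by
  obtain ⟨κ', B', hκ', hB', hdec⟩ := exists_decay_inv_pertCov_QB L a ha hd hαβ ha' hκ0 hγ' hδ' hJA hT0 hT₁ hT₂ hT₃
  have hd1 : 1 ≤ d := le_trans one_le_two hd
  set κ₀ : ℝ := d * (α + β) * Cst d a with hκ₀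
  have hκ₀0 : 0 ≤ κ₀ := by have := Cst_nonneg d a; have := hαβ.1; have := hαβ.2; positivity
  have hC2 : 0 ≤ C2model d L a α β := by
    unfold C2model; have := Cst_nonneg d a; have := hαβ.1; have := hαβ.2; positivity
  -- the uniform rate constant on the disc
  set Cmax : ℝ := ((gammaB d a)⁻¹ * (1 - 1 / 2)⁻¹) ^ 2 * (4 * (CJ d a + T * C2model d L a α β) + 2 * (2 * d * Cst d a + 2 * (d * L * Cst d a)))
    with hCmax
  refine ⟨κ', Real.sqrt (2 * B' * (2 * Cmax / (1 - (L : ℝ)⁻¹))), hκ', fun M _ V hV t ht a'' => ?_⟩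
  have hL1 : (1 : ℝ) < L := by exact_mod_cast (lt_of_lt_of_le one_lt_two hL : 1 < L)
  have hρ0 : (0 : ℝ) ≤ (L : ℝ)⁻¹ := inv_nonneg.mpr (Nat.cast_nonneg _)
  have hρ1 : ((L : ℝ)⁻¹) < 1 := inv_lt_one_of_one_lt₀ hL1
  have hpert := perturbationLaws_firstOrder L M a ha hd1 hV
  have ht₀ : ‖t‖ * κ₀ < 1 := by nlinarith [mul_le_mul_of_nonneg_right ht hκ₀0, norm_nonneg t]
  -- PART 118's Neumann smallness at `θ = 1/2`
  have hθ : (gammaB d a)⁻¹ * (‖t‖ * κ₀ * Cst d a * (1 - ‖t‖ * κ₀)⁻¹) ≤ 1 / 2 := by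
    have hγB : 0 < gammaB d a := gammaB_pos a ha
    have hν : (1 - ‖t‖ * κ₀)⁻¹ ≤ 2 := by
      have h1 : (1 : ℝ) / 2 ≤ 1 - ‖t‖ * κ₀ := by nlinarith [mul_le_mul_of_nonneg_right ht hκ₀0, norm_nonneg t]
      have := inv_anti₀ (by norm_num : (0 : ℝ) < 1 / 2) h1
      rwa [one_div, inv_inv] at this
    have hν0 : 0 ≤ (1 - ‖t‖ * κ₀)⁻¹ := inv_nonneg.mpr (by linarith)
    have hCst := Cst_nonneg d a
    have hT0' : 0 ≤ T := hT0
    have h2 : ‖t‖ * κ₀ * Cst d a * (1 - ‖t‖ * κ₀)⁻¹ ≤ T * κ₀ * Cst d a * 2 :=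
      mul_le_mul (mul_le_mul_of_nonneg_right (mul_le_mul_of_nonneg_right ht hκ₀0) hCst) hν hν0 (by positivity)
    have h3 : T * κ₀ * Cst d a * 2 ≤ gammaB d a / 2 := by linarith
    rw [inv_mul_le_iff₀ hγB]
    linarith
  obtain ⟨Slim, hlim, hrate⟩ := effForm_perturbed_balaban L M a ha hL hpert ht₀ hθ (by norm_num) 0
  simp only [zero_smul, sub_zero] at hlim hrate
  -- the rate constant made uniform on the disc
  have hCp : Cpert κ₀ (2 * d * Cst d a) (CJ d a) (C2model d L a α β) (d * L * Cst d a) t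
      ≤ 4 * (CJ d a + T * C2model d L a α β) + 2 * (2 * d * Cst d a + 2 * (d * L * Cst d a)) :=
    Cpert_le_of_norm_le hκ₀0 (by have := Cst_nonneg d a; positivity) (CJ_nonneg d a) hC2 (by have := Cst_nonneg d a; positivity) ht
      (by rw [hκ₀]; exact hT₁)
  have hrate' : ∀ k, ‖(avgTow (QBlev L M) ((L : ℝ) ^ d) (fun k => (calDalev L M a ha k + t • Pmodel L M V k)⁻¹) k)⁻¹ - Slim‖
      ≤ Cmax * ((L : ℝ)⁻¹) ^ k / (1 - (L : ℝ)⁻¹) := by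
    intro k
    refine (hrate k).trans ?_
    have h1ρ : 0 < 1 - (L : ℝ)⁻¹ := sub_pos.mpr hρ1
    rw [hCmax]
    exact div_le_div_of_nonneg_right (mul_le_mul_of_nonneg_right (mul_le_mul_of_nonneg_left hCp (sq_nonneg _)) (pow_nonneg hρ0 k)) h1ρ.le
  -- the two-level shape for `c_k(t)⁻¹`; the regulator cancels in the differences of `Σ_k(t) = c_k(t)⁻¹ − a″·1`
  have h3 := (decayStations_of_rate hρ0 hρ1 hlim hrate' (fun k => hdec M V hV t ht k)).2.2
  intro k x y
  have e : ((avgTow (QBlev L M) ((L : ℝ) ^ d) (fun k => (calDalev L M a ha k + t • Pmodel L M V k)⁻¹) (k + 1))⁻¹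
        - a'' • (1 : Matrix (idx L M 0) (idx L M 0) ℂ))
      - ((avgTow (QBlev L M) ((L : ℝ) ^ d) (fun k => (calDalev L M a ha k + t • Pmodel L M V k)⁻¹) k)⁻¹
        - a'' • (1 : Matrix (idx L M 0) (idx L M 0) ℂ))
      = (avgTow (QBlev L M) ((L : ℝ) ^ d) (fun k => (calDalev L M a ha k + t • Pmodel L M V k)⁻¹) (k + 1))⁻¹
        - (avgTow (QBlev L M) ((L : ℝ) ^ d) (fun k => (calDalev L M a ha k + t • Pmodel L M V k)⁻¹) k)⁻¹ := by abel
  rw [e]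
  exact h3 k x y

end Balaban

end Summit.QuantumFields.BalabanUV.Beta.GAN24.EffectiveFormDecayBackground

end
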